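/-
Copyright: the b2b-balaban T⁴-continuum CRUX team, row NE7b, leaf prover `t4-ne7b-formalise-leaf-01` (gen 80), on its
`TiltedMeanShiftInterpolated` and the OWNER lineage `t4-ne7b-p1` (gen 106)'s `TiltedMeanShift`; the refuter (gen 70)'s (τ2). Project licence.
-/
import Summits.QuantumFields.BalabanUV.T4Continuum.Spine.NE7b.TiltedMeanShiftInterpolated

/-!
# THE INTERPOLATION END FROM ENDPOINT DATA ONLY: first-order convexity letters are AFFINE in the potential, integrabilities transfer
# along `W + tP` under `|P| ≤ p`, a pointwise `‖∇P‖² ≤ G` serves every `t` — so `…TiltedMeanShiftInterpolated`'s `∀ t ∈ [0,1]`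
# hypotheses reduce to the letters at `t = 0` and `t = 1` (row NE7b, node U5c; model level; the refuter's (τ2), PRICING-NE7b v79 F426)

Cell `pub-balaban`, sub-cell `t4`, spine estimate NE7b (`T4WeightBudget.RelWeightBound` — the cell's OWN estimate, NOT PRINTED in
[Bałaban 1983–89], NOT PROVED).  Crux-route MODEL work under `Spine/NE7b/`; no `T4Continuum/Support` leaf, no `def`, no `Prop` minted,
nothing of Bałaban's named or asserted; 0 `sorry`.

WHY.  `…TiltedMeanShiftInterpolated.abs_tiltedMean_shift_le_interpolated` (the derivative-free interpolation END of the tilted-mean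
shift, refuter κ-ne7bref-g68-6 ∕ idea-1 R-62-1) asks its convexity, integrability and gradient letters for EVERY `t ∈ [0,1]` along
`W + tP`.  The refuter priced the file (PRICING-NE7b v79 F426 ★, TRUE ∕ S) and located (τ2): «`∀ t ∈ Set.Icc 0 1` is NOT an extra letter —
first-order convexity letters are AFFINE in the potential: the ENDPOINT letters (t = 0: W, λ₀; t = 1: W + P, λ₁) give every t with
λ = min(λ₀, λ₁) by convex combination …; `hZ ∕ h1 ∕ h2 ∀ t` follow from t = 0 + `|P| ≤ p`, `hG ∀ t` from the pointwise sup letter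
`‖∇P‖² ≤ G` … a ten-line `…_of_endpoints` corollary suggested».  THIS FILE is that corollary, with its three suppliers:
`integrable_exp_neg_interpolate` (`e^{−(W+tP)} ≤ e^{p}·e^{−W}`), `integrable_tilted_interpolate` (Mathlib `integrable_tilted_iff`: the
densities of `ν_{W+tP}` and `ν_W` differ by the bounded factor `e^{−tP}`), `firstOrder_interpolate` (`⟪∇f x, v⟫ = Df(x)v` by
`inner_gradient_left`; `fderiv_fun_add`, `fderiv_const_mul`; then `(1−t)·[letter of W] + t·[letter of W+P]`), and
**`abs_tiltedMean_shift_le_interpolated_of_endpoints`**: `W` differentiable, `P ∈ C¹` with `|P| ≤ p` and a POINTWISE `‖∇P x‖² ≤ G`,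
the `λ`-uniform first-order convexity letters of `W` AND of `W + P` (same `λ` — take the minimum), `e^{−W}` integrable, `⟪u,·⟫` with
two moments under `ν_W` ⊢ `|𝔼_{W+P}⟪u,x⟫ − 𝔼_W⟪u,x⟫| ≤ λ⁻¹·((a₀∕2)‖u‖² + G∕(2a₀))` for every `a₀ > 0`.

NOT HERE (honest): the endpoint letters for Bałaban's anharmonic remainder on print's windows and the value of `G` ((R2′) family (2)
readings; `…ConvexTiltSuppliers` gives the modulus in the model); anything of Bałaban's.  BY-NAME EFFECT ON THE WALL: NONE.  NE7b NOT
PRINTED ∕ NOT PROVED; spine PROVED 0∕9; rung (B)+1 on a FINITE torus — NOT infinite volume, NOT the mass gap, NOT Clay.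
HONEST DEPENDENCY: continuum YM on T⁴ ⇐ BetaPertH ∧ nine spine estimates (0/9 proved); BetaPertH ⇐ (D1) ∧ (D4) ∧ CAP+tail;
G-an2-4 gates asym, D1 and NE2/3/4.
-/

set_option autoImplicit false

noncomputable section

open MeasureTheory Real
open scoped RealInnerProductSpace
open Summit.QuantumFields.BalabanUV.T4Continuum.NE7b.TiltedMeanShiftInterpolated

namespace Summit.QuantumFields.BalabanUV.T4Continuum.NE7b.TiltedMeanShiftEndpoints

section Euclidean

variable {n : ℕ}

/-- `e^{−(W+tP)}` is integrable for `t ∈ [0,1]` when `e^{−W}` is and `|P| ≤ p` (`W`, `P` continuous). [folklore] -/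
theorem integrable_exp_neg_interpolate {W P : EuclideanSpace ℝ (Fin n) → ℝ} {p t : ℝ} (hWc : Continuous W) (hPc : Continuous P)
    (hp : ∀ x, |P x| ≤ p) (ht : t ∈ Set.Icc (0 : ℝ) 1) (hZ : Integrable fun x => exp (-W x)) :
    Integrable fun x => exp (-(W x + t * P x)) := by
  refine (hZ.const_mul (exp p)).mono' (by fun_prop : Continuous fun x => exp (-(W x + t * P x))).aestronglyMeasurable
    (ae_of_all _ fun x => ?_)
  rw [Real.norm_eq_abs, abs_of_pos (exp_pos _), ← exp_add]
  refine exp_le_exp.mpr ?_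
  have h1 : -(t * P x) ≤ |t * P x| := neg_le_abs _
  have h2 : |t * P x| = |t| * |P x| := abs_mul _ _
  have h3 : |t| ≤ 1 := by rw [abs_of_nonneg ht.1]; exact ht.2
  have h4 : |t| * |P x| ≤ 1 * p := mul_le_mul h3 (hp x) (abs_nonneg _) zero_le_one
  linarith

/-- **INTEGRABILITY TRANSFERS ALONG THE INTERPOLATION**: a real function integrable under `ν_W` is integrable under `ν_{W+tP}` for
`t ∈ [0,1]` when `|P| ≤ p` (`integrable_tilted_iff`: the densities differ by the bounded factor `e^{−tP}`). [folklore] -/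
theorem integrable_tilted_interpolate {W P : EuclideanSpace ℝ (Fin n) → ℝ} {p t : ℝ} (hWc : Continuous W) (hPc : Continuous P)
    (hp : ∀ x, |P x| ≤ p) (ht : t ∈ Set.Icc (0 : ℝ) 1) (hZ : Integrable fun x => exp (-W x))
    {f : EuclideanSpace ℝ (Fin n) → ℝ} (hfm : AEStronglyMeasurable f volume) (hf : Integrable f (volume.tilted fun x => -W x)) :
    Integrable f (volume.tilted fun x => -(W x + t * P x)) := by
  have hZt := integrable_exp_neg_interpolate hWc hPc hp ht hZ
  rw [integrable_tilted_iff hZt]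
  have hf' : Integrable (fun x => exp (-W x) • f x) := (integrable_tilted_iff hZ f).mp hf
  refine (hf'.norm.const_mul (exp p)).mono' ((by fun_prop : Continuous fun x => exp (-(W x + t * P x))).aestronglyMeasurable.smul hfm)
    (ae_of_all _ fun x => ?_)
  simp only [norm_smul, Real.norm_eq_abs, Real.abs_exp]
  rw [← mul_assoc, ← exp_add]
  refine mul_le_mul_of_nonneg_right (exp_le_exp.mpr ?_) (abs_nonneg _)
  have h1 : -(t * P x) ≤ |t * P x| := neg_le_abs _
  have h2 : |t * P x| = |t| * |P x| := abs_mul _ _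
  have h3 : |t| ≤ 1 := by rw [abs_of_nonneg ht.1]; exact ht.2
  have h4 : |t| * |P x| ≤ 1 * p := mul_le_mul h3 (hp x) (abs_nonneg _) zero_le_one
  linarith

/-- **FIRST-ORDER CONVEXITY LETTERS ARE AFFINE IN THE POTENTIAL**: the `λ`-letters of `W` and of `W + P` give the `λ`-letter of
`W + tP` for every `t ∈ [0,1]` (`W`, `P` differentiable; `⟪∇f x, v⟫ = Df(x)v`). [folklore] -/
theorem firstOrder_interpolate {W P : EuclideanSpace ℝ (Fin n) → ℝ} {lam t : ℝ} (hW : Differentiable ℝ W) (hP : Differentiable ℝ P)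
    (hV0 : ∀ x y : EuclideanSpace ℝ (Fin n), W x + ⟪gradient W x, y - x⟫ + lam / 2 * ‖y - x‖ ^ 2 ≤ W y)
    (hV1 : ∀ x y : EuclideanSpace ℝ (Fin n),
      (W x + P x) + ⟪gradient (fun z => W z + P z) x, y - x⟫ + lam / 2 * ‖y - x‖ ^ 2 ≤ W y + P y)
    (ht : t ∈ Set.Icc (0 : ℝ) 1) (x y : EuclideanSpace ℝ (Fin n)) :
    (W x + t * P x) + ⟪gradient (fun z => W z + t * P z) x, y - x⟫ + lam / 2 * ‖y - x‖ ^ 2 ≤ W y + t * P y := by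
  have hWx := hW x
  have hPx := hP x
  have e0 : ⟪gradient W x, y - x⟫ = fderiv ℝ W x (y - x) := inner_gradient_left
  have e1 : ⟪gradient (fun z => W z + P z) x, y - x⟫ = fderiv ℝ W x (y - x) + fderiv ℝ P x (y - x) := by
    rw [inner_gradient_left, fderiv_fun_add hWx hPx, _root_.add_apply]
  have et : ⟪gradient (fun z => W z + t * P z) x, y - x⟫ = fderiv ℝ W x (y - x) + t * fderiv ℝ P x (y - x) := by
    rw [inner_gradient_left, fderiv_fun_add hWx (hPx.const_mul t), fderiv_const_mul hPx t, _root_.add_apply,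
      _root_.smul_apply, smul_eq_mul]
  have a0 := hV0 x y
  have a1 := hV1 x y
  rw [e0] at a0
  rw [e1] at a1
  rw [et]
  have ht0 : 0 ≤ t := ht.1
  have ht1 : 0 ≤ 1 - t := sub_nonneg.mpr ht.2
  nlinarith [mul_le_mul_of_nonneg_left a0 ht1, mul_le_mul_of_nonneg_left a1 ht0]

/-- **THE INTERPOLATION END FROM ENDPOINT DATA ONLY.**  `W` differentiable, `P ∈ C¹` with `|P| ≤ p` and a POINTWISE `‖∇P‖² ≤ G`;
the `λ`-uniform first-order convexity letters of `W` and of `W + P` (take `λ = min(λ₀, λ₁)`); `e^{−W}` integrable and `⟪u,·⟫` with two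
moments under `ν_W`.  Then `|𝔼_{W+P}⟪u,x⟫ − 𝔼_W⟪u,x⟫| ≤ λ⁻¹·((a₀∕2)‖u‖² + G∕(2a₀))` for every `a₀ > 0` — all the `t ∈ [0,1]`
hypotheses of `abs_tiltedMean_shift_le_interpolated` are DERIVED (`firstOrder_interpolate`, `integrable_exp_neg_interpolate`,
`integrable_tilted_interpolate`). [folklore] -/
theorem abs_tiltedMean_shift_le_interpolated_of_endpoints {W P : EuclideanSpace ℝ (Fin n) → ℝ} {lam a₀ p G : ℝ}
    (hlam : 0 < lam) (ha₀ : 0 < a₀) (hW : Differentiable ℝ W) (hP : ContDiff ℝ 1 P) (hp : ∀ x, |P x| ≤ p)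
    (hV0 : ∀ x y : EuclideanSpace ℝ (Fin n), W x + ⟪gradient W x, y - x⟫ + lam / 2 * ‖y - x‖ ^ 2 ≤ W y)
    (hV1 : ∀ x y : EuclideanSpace ℝ (Fin n),
      (W x + P x) + ⟪gradient (fun z => W z + P z) x, y - x⟫ + lam / 2 * ‖y - x‖ ^ 2 ≤ W y + P y)
    (hZ : Integrable fun x => exp (-W x)) (u : EuclideanSpace ℝ (Fin n))
    (h1 : Integrable (fun x => ⟪u, x⟫) (volume.tilted fun x => -W x))
    (h2 : Integrable (fun x => ⟪u, x⟫ ^ 2) (volume.tilted fun x => -W x))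
    (hG : ∀ x, ‖fderiv ℝ P x‖ ^ 2 ≤ G) :
    |∫ x, ⟪u, x⟫ ∂(volume.tilted fun x => -(W x + P x)) - ∫ x, ⟪u, x⟫ ∂(volume.tilted fun x => -W x)| ≤
      lam⁻¹ * (a₀ / 2 * ‖u‖ ^ 2 + G / (2 * a₀)) := by
  have hWc : Continuous W := hW.continuous
  have hPc : Continuous P := hP.continuous
  have hPd : Differentiable ℝ P := hP.differentiable one_ne_zero
  have hgc : Continuous fun x => ‖fderiv ℝ P x‖ ^ 2 := (hP.continuous_fderiv one_ne_zero).norm.pow 2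
  have hic : Continuous fun x : EuclideanSpace ℝ (Fin n) => ⟪u, x⟫ := by fun_prop
  have hZt : ∀ t ∈ Set.Icc (0 : ℝ) 1, Integrable fun x => exp (-(W x + t * P x)) :=
    fun t ht => integrable_exp_neg_interpolate hWc hPc hp ht hZ
  have hprob : ∀ t ∈ Set.Icc (0 : ℝ) 1, IsProbabilityMeasure (volume.tilted fun x : EuclideanSpace ℝ (Fin n) => -(W x + t * P x)) :=
    fun t ht => isProbabilityMeasure_tilted (hZt t ht)
  refine abs_tiltedMean_shift_le_interpolated hlam ha₀ hWc hP hp (fun t ht x y => firstOrder_interpolate hW hPd hV0 hV1 ht x y)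
    hZt u (fun t ht => integrable_tilted_interpolate hWc hPc hp ht hZ hic.aestronglyMeasurable (h1))
    (fun t ht => integrable_tilted_interpolate hWc hPc hp ht hZ (hic.pow 2).aestronglyMeasurable h2)
    (fun t ht => ?_) (fun t ht => ?_)
  · haveI := hprob t ht
    exact integrable_of_continuous_of_abs_le hgc fun x => by rw [abs_of_nonneg (sq_nonneg _)]; exact hG x
  · haveI := hprob t ht
    have h := integral_mono (μ := volume.tilted fun x : EuclideanSpace ℝ (Fin n) => -(W x + t * P x))
      (integrable_of_continuous_of_abs_le hgc fun x => by rw [abs_of_nonneg (sq_nonneg _)]; exact hG x)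
      (integrable_const G) hG
    rwa [integral_const, smul_eq_mul, probReal_univ, one_mul] at h

end Euclidean

end Summit.QuantumFields.BalabanUV.T4Continuum.NE7b.TiltedMeanShiftEndpoints
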